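import Literature.NumberTheory.GaloisRepresentations.CompletionCompositumEmbedding
import Literature.NumberTheory.GaloisRepresentations.CompletionCompositumTower
import HarnessLib

/-!
# The distinguished places `w_v(L)` of a TOWER `L ≤ L' ⊆ K̄` cohere (`w_v(L') ∣ w_v(L)`), and the distinguished isomorphisms
# `θ_L : K_v·ι(L) ≅ L_{w_v(L)}` intertwine inclusions, relative NORMS and the action of `Γ_{K_v}`
# (Cassels–Fröhlich II §10–§11, VII §1.1; Neukirch II (8.1)–(8.4))

Topic `NumberTheory/GaloisRepresentations`; namespace `Literature.NumberTheory.GaloisRepresentations.SemiLocal`.  Sequel of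
`CompletionCompositumEmbedding` (for ONE finite Galois `E/K` with `ιE : E → K̄`: the place `embPlace v ιE` cut out by `ι_v ∘ ιE`, the isomorphism
`compositumEquivEmb v ιE : compositum ιE v ≃ₐ[K_v] E_{w_v}` with `θ(ι_v ιE e) = e`, its `Γ_{K_v}`-equivariance) and of `CompletionCompositumTower`
(for compatible embeddings of a tower `E ≤ E'` and ANY compositum isomorphisms `θ`, `θ'` over `E`, `E'`: the places match, the inclusions and the
relative norms correspond).  HERE the two are combined for nested finite Galois subfields `L ≤ L'` of `K̄` (embeddings `L.val`, `L'.val`, compatible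
by `rfl`; `L'` an `L`-algebra through the inclusion, `LocalWeilDatum.towerAlgebra`):

* §1 ★ `under_embPlace_eq` — **the distinguished places cohere**: `w_v(L') ∩ 𝓞_L = w_v(L)`; `embPlaceOver` — `w_v(L')` as a place of `L'` above
  `w_v(L)`; the `LiesOver` instance as a theorem.
* §2 ★ `compositumEquivEmb_inclusion` — `θ_{L'}(y) = ι_{w'/w}(θ_L y)` for `y ∈ K_v·ι(L) ≤ K_v·ι(L')`.
* §3 ★★ **`compositumEquivEmb_towerNorm`** — `θ_L (N_{K_v·ι(L')/K_v·ι(L)} y) = N_{L'_{w_v(L')}/L_{w_v(L)}} (θ_{L'} y)`: the relative norm of the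
  embedded local layers (the currency of `RelNormCoherentUnits` / `principalCoherentFamilies`) IS the local norm of the completions (the transition of
  Rubin's `U_∞`, `SemilocalUnitTowerCoinvOrbitsNorm`).
* §4 ★ `compositumEquivEmb_smul_absRestrictNormalHom` — `θ_L(d • x) = (res d|_L)_{w_v(L)} (θ_L x)` for EVERY `d ∈ Γ_{K_v}`: the local Galois action on
  `K_v·ι(L)` is the action of the decomposition group through `galAdicCompletionMap`; `absRestrictNormalHom_absGaloisRestrict_smul_embPlace`
  (`res d|_L` fixes `w_v(L)`).

Use (cell `bsd-print-cf2`, brick §4(c)/(e), D2 «local model»): with `NumberFields/RayClassFieldLocalTowerCompositum` (`K_v·ι(K(𝔪v^{n+1})) = E ⊔ ltField π n`)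
and `CompletionCompositumUnitBall` this identifies the norm-coherent principal units of the `𝔓`-tower of `K(𝔪v^{n+1})` with the tree's norm-coherent
families along `E·K_π^{n+1}`.  One definition (`embPlaceOver`, a re-typing of `embPlace`), theorems otherwise; no named fact, no instance, no `sorry`.

## References
* [CasselsFrohlichANT1967] J. W. S. Cassels, A. Fröhlich (eds.), *Algebraic Number Theory* (1967), Ch. II §10 Theorem, §11; Ch. VII §1.1, Prop. 1.2.
* [NeukirchANT1999] J. Neukirch, *Algebraic Number Theory* (1999), Ch. II (8.1)–(8.4).
-/

noncomputable section

open NumberField IsDedekindDomain IntermediateField Field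
open scoped Valued

namespace Literature.NumberTheory.GaloisRepresentations

namespace SemiLocal

open Literature.NumberTheory.Automorphic LocalWeilDatum

variable {K : Type} [Field K] [NumberField K] (v : HeightOneSpectrum (𝓞 K))
  (L L' : IntermediateField K (AlgebraicClosure K)) [NumberField L] [NumberField L'] [IsGalois K L] [IsGalois K L'] (hLL' : L ≤ L')

omit [NumberField K] [NumberField L] [NumberField L'] [IsGalois K L] [IsGalois K L'] in
/-- The embeddings `L.val`, `L'.val` of nested subfields are compatible with the inclusion (`rfl`). [cite: NeukirchANT1999, Ch. II (8.1)] -/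
theorem val_towerAlgebra_algebraMap (e : L) :
    letI := towerAlgebra hLL'
    L'.val (algebraMap L L' e) = L.val e := rfl

omit [NumberField K] [NumberField L] [NumberField L'] [IsGalois K L] [IsGalois K L'] in
/-- `K ⊆ L ⊆ L'` is a scalar tower for `towerAlgebra`. [cite: NeukirchANT1999, Ch. II (8.1)] -/
theorem isScalarTower_towerAlgebra :
    letI := towerAlgebra hLL'
    IsScalarTower K L L' :=
  letI := towerAlgebra hLL'
  IsScalarTower.of_algebraMap_eq fun _ => rfl

/-! ### §1. The distinguished places of a tower cohere -/

include hLL' in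
/-- ★ **`w_v(L') ∩ 𝓞_L = w_v(L)`**: the places cut out by `ι_v` on the layers of a tower are coherent (`under_eq_of_algHom_compositum` for the distinguished
isomorphisms). [cite: CasselsFrohlichANT1967, Ch. II §10 Theorem] [cite: NeukirchANT1999, Ch. II (8.1)–(8.2)] -/
theorem under_embPlace_eq :
    letI := towerAlgebra hLL'
    ((embPlace v L'.val : Place K L' v) : HeightOneSpectrum (𝓞 L')).under (𝓞 L) = (embPlace v L.val : Place K L v) := by
  letI := towerAlgebra hLL'
  haveI := isScalarTower_towerAlgebra L L' hLL'
  exact under_eq_of_algHom_compositum v L.val L'.val (val_towerAlgebra_algebraMap L L' hLL') (compositumHomEmb v L.val)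
    (compositumHomEmb_apply_mk v L.val) (compositumHomEmb v L'.val) (compositumHomEmb_apply_mk v L'.val)

/-- `w_v(L')` as a place of `L'` above `w_v(L)` (for the `L`-algebra structure `towerAlgebra`). [cite: CasselsFrohlichANT1967, Ch. II §10] -/
def embPlaceOver :
    letI := towerAlgebra hLL'
    Place L L' ((embPlace v L.val : Place K L v) : HeightOneSpectrum (𝓞 L)) :=
  letI := towerAlgebra hLL'
  ⟨(embPlace v L'.val : Place K L' v), under_embPlace_eq v L L' hLL'⟩

/-- `embPlaceOver` is `w_v(L')` (coercion). [cite: CasselsFrohlichANT1967, Ch. II §10] -/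
@[simp] theorem coe_embPlaceOver :
    letI := towerAlgebra hLL'
    ((embPlaceOver v L L' hLL' : Place L L' ((embPlace v L.val : Place K L v) : HeightOneSpectrum (𝓞 L))) : HeightOneSpectrum (𝓞 L')) =
      (embPlace v L'.val : Place K L' v) := rfl

/-- The `LiesOver` relation `w_v(L') ∣ w_v(L)` as a theorem (use through `haveI`). [cite: CasselsFrohlichANT1967, Ch. II §10] -/
theorem liesOver_embPlace :
    letI := towerAlgebra hLL'
    ((embPlace v L'.val : Place K L' v) : HeightOneSpectrum (𝓞 L')).asIdeal.LiesOver ((embPlace v L.val : Place K L v) : HeightOneSpectrum (𝓞 L)).asIdeal :=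
  letI := towerAlgebra hLL'
  Place.liesOver (embPlaceOver v L L' hLL')

/-! ### §2. The isomorphisms intertwine the inclusions -/

/-- ★ **`θ_{L'}(y) = ι_{w_v(L')/w_v(L)}(θ_L y)`** for `y ∈ K_v·ι(L) ≤ K_v·ι(L')` (`ι_{w'/w} = adicCompletionOfLiesOver`).
[cite: CasselsFrohlichANT1967, Ch. II §10 Theorem, §11] [cite: NeukirchANT1999, Ch. II (8.2)] -/
theorem compositumEquivEmb_inclusion (y : compositum L.val v) :
    letI := towerAlgebra hLL'
    haveI := liesOver_embPlace v L L' hLL'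
    compositumEquivEmb v L'.val (IntermediateField.inclusion (adjoin_range_le_of_tower v L.val L'.val (val_towerAlgebra_algebraMap L L' hLL')) y) =
      adicCompletionOfLiesOver L L' ((embPlace v L.val : Place K L v) : HeightOneSpectrum (𝓞 L))
        ((embPlace v L'.val : Place K L' v) : HeightOneSpectrum (𝓞 L')) (compositumEquivEmb v L.val y) := by
  letI := towerAlgebra hLL'
  haveI := isScalarTower_towerAlgebra L L' hLL'
  haveI := liesOver_embPlace v L L' hLL'
  rw [compositumEquivEmb_apply, compositumEquivEmb_apply]
  exact algHom_compositum_inclusion v L.val L'.val (val_towerAlgebra_algebraMap L L' hLL') (compositumHomEmb v L.val)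
    (compositumHomEmb_apply_mk v L.val) (compositumHomEmb v L'.val) (compositumHomEmb_apply_mk v L'.val) y

/-! ### §3. The isomorphisms carry relative norms to local norms -/

/-- ★★ **`θ_L (N_{K_v·ι(L')/K_v·ι(L)} y) = N_{L'_{w_v(L')}/L_{w_v(L)}} (θ_{L'} y)`** — the relative norm of the embedded local layers (`towerAlgebra` of the
composita in `K̄_v`) is carried by the distinguished isomorphisms to the local norm of the completions (`algebraPlace` of the place `w_v(L')` above `w_v(L)`).
[cite: CasselsFrohlichANT1967, Ch. II §11] [cite: NeukirchANT1999, Ch. II (8.4)] -/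
theorem compositumEquivEmb_towerNorm (y : compositum L'.val v) :
    letI := towerAlgebra hLL'
    compositumEquivEmb v L.val
        (@Algebra.norm (compositum L.val v) (compositum L'.val v) _ _
          (towerAlgebra (adjoin_range_le_of_tower v L.val L'.val (val_towerAlgebra_algebraMap L L' hLL'))) y) =
      @Algebra.norm (((embPlace v L.val : Place K L v) : HeightOneSpectrum (𝓞 L)).adicCompletion L)
        (((embPlace v L'.val : Place K L' v) : HeightOneSpectrum (𝓞 L')).adicCompletion L') _ _
        (algebraPlace (embPlaceOver v L L' hLL')) (compositumEquivEmb v L'.val y) := by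
  letI := towerAlgebra hLL'
  haveI := isScalarTower_towerAlgebra L L' hLL'
  rw [compositumEquivEmb_apply, compositumEquivEmb_apply]
  exact algHom_compositum_norm v L.val L'.val (val_towerAlgebra_algebraMap L L' hLL') (compositumHomEmb v L.val)
    (compositumHomEmb_apply_mk v L.val) (compositumHomEmb v L'.val) (compositumHomEmb_apply_mk v L'.val) y

/-! ### §4. The action of `Γ_{K_v}` through the decomposition group -/

omit [NumberField L] [IsGalois K L] in
/-- The restriction `res d|_L ∈ Gal(L/K)` of `d ∈ Γ_{K_v}` acts on `ι(L)` as `d` does: `L.val ((res d|_L) e) = res d • L.val e`.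
[cite: CasselsFrohlichANT1967, Ch. VII §1.1] -/
theorem val_absRestrictNormalHom_absGaloisRestrict [Normal K L] (d : absoluteGaloisGroup (v.adicCompletion K)) (e : L) :
    L.val (absRestrictNormalHom L (absGaloisRestrict K (v.adicCompletion K) d) e) =
      absGaloisRestrict K (v.adicCompletion K) d • L.val e :=
  AlgEquiv.restrictNormalHom_apply L _ e

/-- ★ `res d|_L` fixes the distinguished place `w_v(L)` for every `d ∈ Γ_{K_v}`. [cite: CasselsFrohlichANT1967, Ch. VII §1.1] -/
theorem absRestrictNormalHom_absGaloisRestrict_smul_embPlace (d : absoluteGaloisGroup (v.adicCompletion K)) :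
    absRestrictNormalHom L (absGaloisRestrict K (v.adicCompletion K) d) • embPlace v L.val = embPlace v L.val :=
  smul_embPlace_eq v L.val (val_absRestrictNormalHom_absGaloisRestrict v L d)

/-- Coerced form in the places of `L`. [cite: CasselsFrohlichANT1967, Ch. VII §1.1] -/
theorem absRestrictNormalHom_absGaloisRestrict_smul_coe_embPlace (d : absoluteGaloisGroup (v.adicCompletion K)) :
    absRestrictNormalHom L (absGaloisRestrict K (v.adicCompletion K) d) • ((embPlace v L.val : Place K L v) : HeightOneSpectrum (𝓞 L)) =
      (embPlace v L.val : Place K L v) :=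
  smul_coe_embPlace_eq v L.val (val_absRestrictNormalHom_absGaloisRestrict v L d)

omit [NumberField L] [IsGalois K L] in
/-- `K_v·ι(L)` is stable under `Γ_{K_v}` (`L/K` normal). [cite: CasselsFrohlichANT1967, Ch. VII §1.1] -/
theorem smul_mem_compositum_val [Normal K L] (d : absoluteGaloisGroup (v.adicCompletion K)) {x : AlgebraicClosure (v.adicCompletion K)}
    (hx : x ∈ compositum L.val v) : d • x ∈ compositum L.val v :=
  smul_mem_compositum v L.val (val_absRestrictNormalHom_absGaloisRestrict v L d) hx

/-- ★ **`θ_L(d • x) = (res d|_L)_{w_v(L)} (θ_L x)` for every `d ∈ Γ_{K_v}`**: the local Galois action on the embedded layer `K_v·ι(L)` is the action of the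
decomposition group of `w_v(L)` on the completion (`galAdicCompletionMap`). [cite: CasselsFrohlichANT1967, Ch. VII §1.1, Prop. 1.2] -/
theorem compositumEquivEmb_smul_absRestrictNormalHom (d : absoluteGaloisGroup (v.adicCompletion K)) (x : compositum L.val v) :
    compositumEquivEmb v L.val ⟨d • (x : AlgebraicClosure (v.adicCompletion K)), smul_mem_compositum_val v L d x.2⟩ =
      galAdicCompletionMap (absRestrictNormalHom L (absGaloisRestrict K (v.adicCompletion K) d))
        (absRestrictNormalHom_absGaloisRestrict_smul_coe_embPlace v L d) (compositumEquivEmb v L.val x) :=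
  compositumEquivEmb_smul v L.val (val_absRestrictNormalHom_absGaloisRestrict v L d) x

end SemiLocal

end Literature.NumberTheory.GaloisRepresentations

end
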